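/-
Copyright: the b2b-balaban T⁴-continuum CRUX team, row NE7b OWNER lineage `t4-ne7b-p1` (gen 131). Project licence.
-/
import Summits.QuantumFields.BalabanUV.T4Continuum.Spine.NE7b.SupRegulatedTiltedMoments
import Summits.QuantumFields.BalabanUV.T4Continuum.Spine.NE7b.SupNextPotentialCubicTaylor

/-!
# THE CUBIC TAYLOR LETTER OF THE NEXT POTENTIAL ON THE ROAD — THE TILTED MOMENT LETTERS DISCHARGED: on the road's step over the cells of `S`
# (`V_t = Σ_{p∈S}Σ_{x∈cell p} w_x(ω_x + ψ₀,x + th_x) = Σ_{x∈⋃_S cells} …`) with a finite-range Gaussian, sup-small stable `C³` remainders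
# and KP smallness at the small-field radius `Ψ` holding at BOTH ends `ψ₀`, `ψ₀ + h` of the segment, (329)'s single-site tilted moments
# give `L₁ = (1+δ₀⁻¹)M′`, `L₂ = δ₀⁻¹M′`, `L₃ = (1+2δ₀⁻²)M′`, `M′ = exp(2(Δ+1)2e·ε̃_ΨA_τ^v)`, UNIFORMLY on the segment and in the volume, so
# (338)'s `cubic_taylor_line` yields
#   `|log Z_S(ψ₀+h) − log Z_S(ψ₀) − (log Z_S)′(0) − ½(log Z_S)″(0)| ≤ (E₃ + 3E₁E₂ + 2E₁³)∕6`
# (and the two companions) with EXPLICIT O(1)·(Σ|h|)³ letters — the third-order re-entry of the next remainder on the scalar road, HONESTLY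
# without contraction (row NE7b, node U5c; (329)∕(323)∕(337b)∕(338) BY NAME; [folklore])

Cell `pub-balaban`, sub-cell `t4`, spine estimate NE7b (`T4WeightBudget.RelWeightBound`; the cell's OWN estimate — NOT PRINTED in
[Bałaban 1983–89], NOT PROVED).  Crux-route work under `Spine/NE7b/` by the row OWNER (`t4-ne7b-p1` gen 131, file (339)) under FREEZE
(0)'s crux-prover clause, on § [NE7bP1-G130-HANDOFF] NEXT (3)(a) ∕ ADDENDUM («discharge `L_k` by (329) `tilted_mean_le_of_supSmall`»);
NOTHING of Bałaban's is named as a Lean object, valued or asserted; no `T4Continuum/Support` leaf typed; no `def`, no notation; zero `sorry`.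
Imports (BY NAME): the OWNER's (329) `…SupRegulatedTiltedMoments` (`tilted_mean_le_of_supSmall`), (323) (`sq_le_inv_mul_exp_sq`,
`abs_cube_le_mul_exp_sq`, `integrable_exp_neg_mul_expSq`), (297) (`cellSum_eq_sum_biUnion`), (313) (`mul_opBound_le_of_le`), (337b) (`lineZ_pos`),
(338) `…SupNextPotentialCubicTaylor` (`cubic_taylor_line`).

WHAT IS PROVED ([folklore]):
* §1 `abs_le_mul_exp_sq` (`|t| ≤ (1+δ⁻¹)e^{δt²}`), `sum_sq_segment_le` (the small-field letter interpolates along the segment by convexity),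
  `integrable_mul_of_dominated`;
* §2 **`letter_phi`**: for `t ∈ [0,1]`, `x ∈ ⋃_S cells` and any measurable `0 ≤ φ ≤ a·e^{δ₀u²}`: `e^{−V_t}φ(u_x)` is integrable and
  `∫e^{−V_t}φ(u_x) ≤ Z(t)·(a·M′)` ((329) at the field `ψ₀ + th`, rewritten to the `⋃_S cells` form);
* §3 THE END **`cubic_taylor_road`**: the three Taylor letters of `t ↦ log Z_S(ψ₀ + th)` between `0` and `1` with `M = E₃ + 3E₁E₂ + 2E₁³`,
  `E₁ = κ₁Σ|h|L₁`, `E₂ = κ₁²#YΣh²L₂ + κ₂Σh²`, `E₃ = κ₁³#Y²Σ|h|³L₃ + 3κ₂Σh²·κ₁Σ|h|L₁ + κ₃Σ|h|³` (`Y = ⋃_S cells`) and the `L_k` above; §4 toy.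

HONEST (what this is NOT).  One fluctuation step on the scalar road, the next field on the SAME sites: the cubic letter is O(1)·(Σ|h|)³·#Y² —
NO contraction without blocking ∕ rescaling (SCOPING-d4); `(336b)`'s domination slack is taken as `δ = δ₀(1+τ)∕2` from `2(κ₀+δ₀) ≤ κ`;
scalar skeleton ((A3), NC-NE7b-α UNRULED); nothing of Bałaban's asserted.  BY-NAME EFFECT ON THE WALL: NONE.  NE7b NOT PRINTED ∕ NOT PROVED;
spine PROVED 0∕9; rung (B)+1 — the programme's measures remain FINITE-torus statements; NOT the mass gap, NOT Clay.  HONEST DEPENDENCY: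
continuum YM on T⁴ ⇐ BetaPertH ∧ nine spine estimates (0∕9 proved); BetaPertH ⇐ (D1) ∧ (D4) ∧ CAP+tail; G-an2-4 gates asym, D1 and NE2∕3∕4.
-/

set_option autoImplicit false

noncomputable section

namespace Summit.QuantumFields.BalabanUV.T4Continuum.NE7b.SupNextPotentialCubicRoad

open MeasureTheory ProbabilityTheory Finset Real Set
open scoped BigOperators
open Literature.Analysis.Matrix (HasFiniteRange)
open SupSmallFieldGasReal (cellSum_eq_sum_biUnion)
open SupRegulatedTiltedMoments (tilted_mean_le_of_supSmall)
open SupTiltedSingleSiteMoments (sq_le_inv_mul_exp_sq abs_cube_le_mul_exp_sq integrable_exp_neg_mul_expSq)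
open SupNextPotentialThirdLetter (lineZ_pos)
open SupNextPotentialCubicTaylor (cubic_taylor_line)
open SupEffectiveActionDerivative (mul_opBound_le_of_le)

/-! ## §1. Elementary -/

/-- `0 < δ ⟹ |t| ≤ (1 + δ⁻¹)·e^{δt²}` (`|t| ≤ 1 + t²`, `1 ≤ eˣ`, `t² ≤ δ⁻¹eˣ`). [folklore] -/
theorem abs_le_mul_exp_sq {δ : ℝ} (hδ : 0 < δ) (t : ℝ) : |t| ≤ (1 + δ⁻¹) * exp (δ * t ^ 2) := by
  have h1 : 1 ≤ exp (δ * t ^ 2) := one_le_exp (by positivity)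
  have h2 := sq_le_inv_mul_exp_sq hδ t
  have h3 : |t| ≤ 1 + t ^ 2 := by nlinarith [sq_nonneg (|t| - 1), sq_abs t, abs_nonneg t]
  nlinarith [inv_pos.2 hδ]

/-- On the segment the small-field letter interpolates: `Σ_P ψ₀² ≤ Ψ²`, `Σ_P (ψ₀+h)² ≤ Ψ²`, `0 ≤ t ≤ 1` ⟹ `Σ_P (ψ₀+th)² ≤ Ψ²` (convexity of
the square). [folklore] -/
theorem sum_sq_segment_le {ι : Type*} (P : Finset ι) (ψ₀ h : ι → ℝ) {Ψ t : ℝ} (ht0 : 0 ≤ t) (ht1 : t ≤ 1)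
    (h0 : ∑ x ∈ P, ψ₀ x ^ 2 ≤ Ψ ^ 2) (h1 : ∑ x ∈ P, (ψ₀ x + h x) ^ 2 ≤ Ψ ^ 2) :
    ∑ x ∈ P, (ψ₀ x + t * h x) ^ 2 ≤ Ψ ^ 2 := by
  have hpt : ∀ x ∈ P, (ψ₀ x + t * h x) ^ 2 ≤ (1 - t) * ψ₀ x ^ 2 + t * (ψ₀ x + h x) ^ 2 := fun x _ => by
    nlinarith [mul_nonneg (mul_nonneg ht0 (sub_nonneg.2 ht1)) (sq_nonneg (h x))]
  calc ∑ x ∈ P, (ψ₀ x + t * h x) ^ 2 ≤ ∑ x ∈ P, ((1 - t) * ψ₀ x ^ 2 + t * (ψ₀ x + h x) ^ 2) := sum_le_sum hpt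
    _ = (1 - t) * ∑ x ∈ P, ψ₀ x ^ 2 + t * ∑ x ∈ P, (ψ₀ x + h x) ^ 2 := by rw [sum_add_distrib, mul_sum, mul_sum]
    _ ≤ (1 - t) * Ψ ^ 2 + t * Ψ ^ 2 := by nlinarith [sub_nonneg.2 ht1]
    _ = Ψ ^ 2 := by ring

section Abstract

variable {Ω : Type*} [MeasurableSpace Ω] {μ : Measure Ω}

/-- **Domination ⟹ integrability**: `E·D` integrable, `E, Φ ≥ 0` measurable, `Φ ≤ a·D` ⟹ `E·Φ` integrable. [folklore] -/
theorem integrable_mul_of_dominated {E Φ D : Ω → ℝ} {a : ℝ} (hD : Integrable (fun ω => E ω * D ω) μ) (hEm : Measurable E)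
    (hΦm : Measurable Φ) (hE0 : ∀ ω, 0 ≤ E ω) (hΦ0 : ∀ ω, 0 ≤ Φ ω) (hdom : ∀ ω, Φ ω ≤ a * D ω) :
    Integrable (fun ω => E ω * Φ ω) μ := by
  refine (hD.const_mul a).mono' (hEm.mul hΦm).aestronglyMeasurable (ae_of_all _ fun ω => ?_)
  rw [Real.norm_eq_abs, abs_of_nonneg (mul_nonneg (hE0 ω) (hΦ0 ω))]
  calc E ω * Φ ω ≤ E ω * (a * D ω) := mul_le_mul_of_nonneg_left (hdom ω) (hE0 ω)
    _ = a * (E ω * D ω) := by ring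

end Abstract

/-! ## §2. The road's single-site letters along the segment, in the `⋃_S cells` form -/

variable {ι : Type} [Fintype ι] [DecidableEq ι] {V : Type*} [DecidableEq V]

section Main

variable {Γ : Matrix ι ι ℝ} {γop γ : ℝ} {dι : ι → ι → ℕ} {ρ : ℕ} {cell : V → Finset ι} {v : ℕ} {R : V → V → Prop}
  [DecidableRel R] [Std.Symm R] {nbr : V → Finset V} {Δ : ℕ} {w w' w'' w₃ : ι → ℝ → ℝ} {κ₀ κ₁ κ₂ κ₃ δ₀ b r κ τ θ Ψ : ℝ}

/-- **The single-site letter along the segment** for any measurable `0 ≤ φ ≤ a·e^{δ₀u²}`: road data as in (329) (finite-range Gaussian,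
disjoint cells of `≤ v` sites, `Δ`-bounded cell graph covering `ρ`-closeness, measurable stable sup-small remainders, `0 < δ₀`,
`2(κ₀+δ₀) ≤ κ`, `κ(1+τ)γ_op ≤ θ ∈ (0,1)`), the small-field letter at BOTH ends of the segment and KP smallness ⟹ for `t ∈ [0,1]` and
`x ∈ ⋃_S cells`: `e^{−V_t}φ(u_x)` is integrable and `∫e^{−V_t}φ(u_x) ≤ Z(t)·(a·M′)`. [folklore] -/
theorem letter_phi (hΓ : Γ.PosSemidef) (hΓop : (γop • (1 : Matrix ι ι ℝ) - Γ).PosSemidef) (hdiag : ∀ i, Γ i i ≤ γ)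
    (hγ : 0 ≤ γ) (hfr : HasFiniteRange dι ρ Γ) (hdisj : ∀ p q, p ≠ q → Disjoint (cell p) (cell q)) (hv : ∀ p, (cell p).card ≤ v)
    (hR : ∀ (p p' : V) (x y : ι), x ∈ cell p → y ∈ cell p' → dι x y ≤ ρ → p = p' ∨ R p p')
    (hΔ : ∀ x, (nbr x).card ≤ Δ) (hnbr : ∀ x y, R x y → y ∈ nbr x) (hw : ∀ x, Measurable (w x))
    (hκ₀ : 0 ≤ κ₀) (hδ₀ : 0 < δ₀) (hb : 0 ≤ b) (hr : 0 ≤ r) (hstab : ∀ x, ∀ t : ℝ, -(κ₀ * t ^ 2) ≤ w x t)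
    (hsup : ∀ x, ∀ t : ℝ, |t| ≤ r → |w x t| ≤ b) (hκ : 2 * (κ₀ + δ₀) ≤ κ)
    (hτ : 0 < τ) (hθ0 : 0 < θ) (hθ1 : θ < 1) (hκθ : κ * (1 + τ) * γop ≤ θ) (S : Finset V) (ψ₀ h : ι → ℝ)
    (hψ0 : ∀ p ∈ S, ∑ x ∈ cell p, ψ₀ x ^ 2 ≤ Ψ ^ 2) (hψ1 : ∀ p ∈ S, ∑ x ∈ cell p, (ψ₀ x + h x) ^ 2 ≤ Ψ ^ 2)
    (hsmall : Real.exp 1 * (((max (exp (v * (b + δ₀ * r ^ 2)) - 1) (2 * exp (-((κ / 2 - (κ₀ + δ₀)) * r ^ 2)))) * exp (κ * (1 + τ⁻¹) * Ψ ^ 2 / 2)) * ((1 - θ) ^ (-(κ * (1 + τ) * γ / (2 * θ)))) ^ v) * ((Δ : ℝ) + 1) ^ 2 ≤ 1 / 2)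
    {φ : ℝ → ℝ} {a : ℝ} (hφm : Measurable φ) (hφ0 : ∀ u, 0 ≤ φ u) (hφ : ∀ u, φ u ≤ a * exp (δ₀ * u ^ 2)) :
    ∀ t ∈ Icc (0 : ℝ) 1, ∀ x ∈ S.biUnion cell,
      Integrable (fun ω : EuclideanSpace ℝ ι => exp (-(∑ x ∈ S.biUnion cell, w x (ω x + (ψ₀ x + t * h x)))) * φ (ω x + (ψ₀ x + t * h x))) (multivariateGaussian 0 Γ) ∧
        ∫ ω : EuclideanSpace ℝ ι, exp (-(∑ x ∈ S.biUnion cell, w x (ω x + (ψ₀ x + t * h x)))) * φ (ω x + (ψ₀ x + t * h x)) ∂(multivariateGaussian 0 Γ) ≤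
          (∫ ω : EuclideanSpace ℝ ι, exp (-(∑ x ∈ S.biUnion cell, w x (ω x + (ψ₀ x + t * h x)))) ∂(multivariateGaussian 0 Γ)) *
            (a * exp (2 * ((1 : ℝ) * ((Δ : ℝ) + 1) * (2 * (Real.exp 1 * (((max (exp (v * (b + δ₀ * r ^ 2)) - 1) (2 * exp (-((κ / 2 - (κ₀ + δ₀)) * r ^ 2)))) * exp (κ * (1 + τ⁻¹) * Ψ ^ 2 / 2)) *
              ((1 - θ) ^ (-(κ * (1 + τ) * γ / (2 * θ)))) ^ v)))))) := by
  intro t ht x hx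
  obtain ⟨p₀, hp₀, hy⟩ := Finset.mem_biUnion.1 hx
  set ψt : EuclideanSpace ℝ ι := WithLp.toLp 2 (fun x => ψ₀ x + t * h x) with hψt
  have hψ : ∀ p ∈ S, ∑ x ∈ cell p, ψt x ^ 2 ≤ Ψ ^ 2 := fun p hp =>
    sum_sq_segment_le (cell p) ψ₀ h ht.1 ht.2 (hψ0 p hp) (hψ1 p hp)
  have hκθ₀ : 2 * κ₀ * (1 + τ) * γop ≤ θ := by
    have := mul_opBound_le_of_le (a := 2 * κ₀ * (1 + τ)) (b := κ * (1 + τ)) (by positivity)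
      (mul_le_mul_of_nonneg_right (by linarith) (by linarith)) hθ0.le (by simpa [mul_assoc] using hκθ)
    simpa [mul_assoc] using this
  have hκθ₁ : 2 * (κ₀ + δ₀) * (1 + τ) * γop ≤ θ := by
    have := mul_opBound_le_of_le (a := 2 * (κ₀ + δ₀) * (1 + τ)) (b := κ * (1 + τ)) (by positivity)
      (mul_le_mul_of_nonneg_right hκ (by linarith)) hθ0.le (by simpa [mul_assoc] using hκθ)
    simpa [mul_assoc] using this
  obtain ⟨-, hZ⟩ := lineZ_pos hΓ hΓop (S.biUnion cell) hw hκ₀ hτ hθ1 hκθ₀ hstab ψ₀ h t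
  -- the letter from (329) on the tilted law at `ψt`
  have key := tilted_mean_le_of_supSmall hΓ hΓop hdiag hγ hfr hdisj hv hR hΔ hnbr hw hκ₀ hδ₀.le hb hr hstab hsup hκ hτ hθ0 hθ1 hκθ
    S ψt hψ hp₀ hy hsmall hφ0 hφ
  simp only [hψt, WithLp.ofLp_toLp, cellSum_eq_sum_biUnion cell hdisj S] at key
  rw [inv_mul_le_iff₀ hZ] at key
  -- integrability by domination
  have hD := integrable_exp_neg_mul_expSq hΓ hΓop hdisj hw hκ₀ hδ₀.le hstab hτ hθ1 hκθ₁ S ψt hp₀ hy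
  simp only [hψt, WithLp.ofLp_toLp, cellSum_eq_sum_biUnion cell hdisj S] at hD
  have hsite : Measurable fun ω : EuclideanSpace ℝ ι => (ω x + (ψ₀ x + t * h x)) :=
    (by fun_prop : Measurable fun ω : EuclideanSpace ℝ ι => ω x).add_const _
  have hEm : Measurable fun ω : EuclideanSpace ℝ ι => exp (-(∑ x ∈ S.biUnion cell, w x (ω x + (ψ₀ x + t * h x)))) :=
    measurable_exp.comp (Finset.measurable_sum _ fun x _ =>
      (hw x).comp ((by fun_prop : Measurable fun ω : EuclideanSpace ℝ ι => ω x).add_const _)).neg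
  exact ⟨integrable_mul_of_dominated hD hEm (hφm.comp hsite) (fun ω => (exp_pos _).le) (fun ω => hφ0 _) (fun ω => hφ _), key⟩

/-! ## §3. THE END: the cubic Taylor letter of the next potential on the road -/

/-- **THE CUBIC TAYLOR LETTER OF THE NEXT POTENTIAL ON THE ROAD.**  Road data as in `letter_phi`, `C³` remainders with the letters
`|w′| ≤ κ₁|u|`, `|w″| ≤ κ₂`, `|w‴| ≤ κ₃` (`κ₁, κ₂, κ₃ ≥ 0`, `w‴` measurable), the small-field letter at both ends `ψ₀`, `ψ₀ + h` and KP
smallness ⟹ with `Y = ⋃_S cells`, `M′ = exp(2(Δ+1)2e·ε̃_ΨA_τ^v)`, `L₁ = (1+δ₀⁻¹)M′`, `L₂ = δ₀⁻¹M′`, `L₃ = (1+2(δ₀²)⁻¹)M′` and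
`M = E₃ + 3E₁E₂ + 2E₁³`: `|log Z(ψ₀+h) − log Z(ψ₀) − (Z′∕Z)(0) − ½((Z″Z − Z′Z′)∕Z²)(0)| ≤ M∕6`, `|(Z′∕Z)(1) − (Z′∕Z)(0) − ((Z″Z − Z′Z′)∕Z²)(0)| ≤ M∕2`,
`|((Z″Z − Z′Z′)∕Z²)(1) − ((Z″Z − Z′Z′)∕Z²)(0)| ≤ M`. [folklore] -/
theorem cubic_taylor_road (hΓ : Γ.PosSemidef) (hΓop : (γop • (1 : Matrix ι ι ℝ) - Γ).PosSemidef) (hdiag : ∀ i, Γ i i ≤ γ)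
    (hγ : 0 ≤ γ) (hfr : HasFiniteRange dι ρ Γ) (hdisj : ∀ p q, p ≠ q → Disjoint (cell p) (cell q)) (hv : ∀ p, (cell p).card ≤ v)
    (hR : ∀ (p p' : V) (x y : ι), x ∈ cell p → y ∈ cell p' → dι x y ≤ ρ → p = p' ∨ R p p')
    (hΔ : ∀ x, (nbr x).card ≤ Δ) (hnbr : ∀ x y, R x y → y ∈ nbr x)
    (hw' : ∀ x t, HasDerivAt (w x) (w' x t) t) (hw'' : ∀ x t, HasDerivAt (w' x) (w'' x t) t) (hw₃ : ∀ x t, HasDerivAt (w'' x) (w₃ x t) t)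
    (hw₃m : ∀ x, Measurable (w₃ x)) (hκ₁ : 0 ≤ κ₁) (hκ₂ : 0 ≤ κ₂) (hκ₃ : 0 ≤ κ₃)
    (hw'b : ∀ x u, |w' x u| ≤ κ₁ * |u|) (hw''b : ∀ x u, |w'' x u| ≤ κ₂) (hw₃b : ∀ x u, |w₃ x u| ≤ κ₃)
    (hκ₀ : 0 ≤ κ₀) (hδ₀ : 0 < δ₀) (hb : 0 ≤ b) (hr : 0 ≤ r) (hstab : ∀ x, ∀ t : ℝ, -(κ₀ * t ^ 2) ≤ w x t)
    (hsup : ∀ x, ∀ t : ℝ, |t| ≤ r → |w x t| ≤ b) (hκ : 2 * (κ₀ + δ₀) ≤ κ)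
    (hτ : 0 < τ) (hθ0 : 0 < θ) (hθ1 : θ < 1) (hκθ : κ * (1 + τ) * γop ≤ θ) (S : Finset V) (ψ₀ h : ι → ℝ)
    (hψ0 : ∀ p ∈ S, ∑ x ∈ cell p, ψ₀ x ^ 2 ≤ Ψ ^ 2) (hψ1 : ∀ p ∈ S, ∑ x ∈ cell p, (ψ₀ x + h x) ^ 2 ≤ Ψ ^ 2)
    (hsmall : Real.exp 1 * (((max (exp (v * (b + δ₀ * r ^ 2)) - 1) (2 * exp (-((κ / 2 - (κ₀ + δ₀)) * r ^ 2)))) * exp (κ * (1 + τ⁻¹) * Ψ ^ 2 / 2)) * ((1 - θ) ^ (-(κ * (1 + τ) * γ / (2 * θ)))) ^ v) * ((Δ : ℝ) + 1) ^ 2 ≤ 1 / 2) :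
    |Real.log (∫ ω : EuclideanSpace ℝ ι, exp (-(∑ x ∈ S.biUnion cell, w x (ω x + (ψ₀ x + h x)))) ∂(multivariateGaussian 0 Γ)) -
          Real.log (∫ ω : EuclideanSpace ℝ ι, exp (-(∑ x ∈ S.biUnion cell, w x (ω x + ψ₀ x))) ∂(multivariateGaussian 0 Γ)) -
        (∫ ω : EuclideanSpace ℝ ι, exp (-(∑ x ∈ S.biUnion cell, w x (ω x + ψ₀ x))) * -(∑ x ∈ S.biUnion cell, w' x (ω x + ψ₀ x) * h x) ∂(multivariateGaussian 0 Γ)) /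
          (∫ ω : EuclideanSpace ℝ ι, exp (-(∑ x ∈ S.biUnion cell, w x (ω x + ψ₀ x))) ∂(multivariateGaussian 0 Γ)) -
        ((∫ ω : EuclideanSpace ℝ ι, exp (-(∑ x ∈ S.biUnion cell, w x (ω x + ψ₀ x))) * ((∑ x ∈ S.biUnion cell, w' x (ω x + ψ₀ x) * h x) * (∑ x ∈ S.biUnion cell, w' x (ω x + ψ₀ x) * h x) - (∑ x ∈ S.biUnion cell, w'' x (ω x + ψ₀ x) * h x ^ 2)) ∂(multivariateGaussian 0 Γ)) *
            (∫ ω : EuclideanSpace ℝ ι, exp (-(∑ x ∈ S.biUnion cell, w x (ω x + ψ₀ x))) ∂(multivariateGaussian 0 Γ)) -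
          (∫ ω : EuclideanSpace ℝ ι, exp (-(∑ x ∈ S.biUnion cell, w x (ω x + ψ₀ x))) * -(∑ x ∈ S.biUnion cell, w' x (ω x + ψ₀ x) * h x) ∂(multivariateGaussian 0 Γ)) *
            (∫ ω : EuclideanSpace ℝ ι, exp (-(∑ x ∈ S.biUnion cell, w x (ω x + ψ₀ x))) * -(∑ x ∈ S.biUnion cell, w' x (ω x + ψ₀ x) * h x) ∂(multivariateGaussian 0 Γ))) /
          (∫ ω : EuclideanSpace ℝ ι, exp (-(∑ x ∈ S.biUnion cell, w x (ω x + ψ₀ x))) ∂(multivariateGaussian 0 Γ)) ^ 2 / 2| ≤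
      ((κ₁ ^ 3 * ((S.biUnion cell).card : ℝ) ^ 2 * (∑ x ∈ S.biUnion cell, |h x| ^ 3) * ((1 + 2 * (δ₀ ^ 2)⁻¹) * exp (2 * ((1 : ℝ) * ((Δ : ℝ) + 1) * (2 * (Real.exp 1 * (((max (exp (v * (b + δ₀ * r ^ 2)) - 1) (2 * exp (-((κ / 2 - (κ₀ + δ₀)) * r ^ 2)))) * exp (κ * (1 + τ⁻¹) * Ψ ^ 2 / 2)) * ((1 - θ) ^ (-(κ * (1 + τ) * γ / (2 * θ)))) ^ v)))))) + 3 * (κ₂ * (∑ x ∈ S.biUnion cell, h x ^ 2)) * (κ₁ * (∑ x ∈ S.biUnion cell, |h x|) * ((1 + δ₀⁻¹) * exp (2 * ((1 : ℝ) * ((Δ : ℝ) + 1) * (2 * (Real.exp 1 * (((max (exp (v * (b + δ₀ * r ^ 2)) - 1) (2 * exp (-((κ / 2 - (κ₀ + δ₀)) * r ^ 2)))) * exp (κ * (1 + τ⁻¹) * Ψ ^ 2 / 2)) * ((1 - θ) ^ (-(κ * (1 + τ) * γ / (2 * θ)))) ^ v))))))) + κ₃ * (∑ x ∈ S.biUnion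 cell, |h x| ^ 3)) +
          3 * (κ₁ * (∑ x ∈ S.biUnion cell, |h x|) * ((1 + δ₀⁻¹) * exp (2 * ((1 : ℝ) * ((Δ : ℝ) + 1) * (2 * (Real.exp 1 * (((max (exp (v * (b + δ₀ * r ^ 2)) - 1) (2 * exp (-((κ / 2 - (κ₀ + δ₀)) * r ^ 2)))) * exp (κ * (1 + τ⁻¹) * Ψ ^ 2 / 2)) * ((1 - θ) ^ (-(κ * (1 + τ) * γ / (2 * θ)))) ^ v))))))) * (κ₁ ^ 2 * (S.biUnion cell).card * (∑ x ∈ S.biUnion cell, h x ^ 2) * (δ₀⁻¹ * exp (2 * ((1 : ℝ) * ((Δ : ℝ) + 1) * (2 * (Real.exp 1 * (((max (exp (v * (b + δ₀ * r ^ 2)) - 1) (2 * exp (-((κ / 2 - (κ₀ + δ₀)) * r ^ 2)))) * exp (κ * (1 + τ⁻¹) * Ψ ^ 2 / 2)) * ((1 - θ) ^ (-(κ * (1 + τ) * γ / (2 * θ)))) ^ v)))))) + κ₂ * (∑ x ∈ S.biUnion cell, h x ^ 2)) + 2 * (κ₁ * (∑ x ∈ S.biUnion cell, |h x|) * ((1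 + δ₀⁻¹) * exp (2 * ((1 : ℝ) * ((Δ : ℝ) + 1) * (2 * (Real.exp 1 * (((max (exp (v * (b + δ₀ * r ^ 2)) - 1) (2 * exp (-((κ / 2 - (κ₀ + δ₀)) * r ^ 2)))) * exp (κ * (1 + τ⁻¹) * Ψ ^ 2 / 2)) * ((1 - θ) ^ (-(κ * (1 + τ) * γ / (2 * θ)))) ^ v))))))) ^ 3) / 6 ∧
    |(∫ ω : EuclideanSpace ℝ ι, exp (-(∑ x ∈ S.biUnion cell, w x (ω x + (ψ₀ x + h x)))) * -(∑ x ∈ S.biUnion cell, w' x (ω x + (ψ₀ x + h x)) * h x) ∂(multivariateGaussian 0 Γ)) /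
          (∫ ω : EuclideanSpace ℝ ι, exp (-(∑ x ∈ S.biUnion cell, w x (ω x + (ψ₀ x + h x)))) ∂(multivariateGaussian 0 Γ)) -
        (∫ ω : EuclideanSpace ℝ ι, exp (-(∑ x ∈ S.biUnion cell, w x (ω x + ψ₀ x))) * -(∑ x ∈ S.biUnion cell, w' x (ω x + ψ₀ x) * h x) ∂(multivariateGaussian 0 Γ)) /
          (∫ ω : EuclideanSpace ℝ ι, exp (-(∑ x ∈ S.biUnion cell, w x (ω x + ψ₀ x))) ∂(multivariateGaussian 0 Γ)) -
        ((∫ ω : EuclideanSpace ℝ ι, exp (-(∑ x ∈ S.biUnion cell, w x (ω x + ψ₀ x))) * ((∑ x ∈ S.biUnion cell, w' x (ω x + ψ₀ x) * h x) * (∑ x ∈ S.biUnion cell, w' x (ω x + ψ₀ x) * h x) - (∑ x ∈ S.biUnion cell, w'' x (ω x + ψ₀ x) * h x ^ 2)) ∂(multivariateGaussian 0 Γ)) *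
            (∫ ω : EuclideanSpace ℝ ι, exp (-(∑ x ∈ S.biUnion cell, w x (ω x + ψ₀ x))) ∂(multivariateGaussian 0 Γ)) -
          (∫ ω : EuclideanSpace ℝ ι, exp (-(∑ x ∈ S.biUnion cell, w x (ω x + ψ₀ x))) * -(∑ x ∈ S.biUnion cell, w' x (ω x + ψ₀ x) * h x) ∂(multivariateGaussian 0 Γ)) *
            (∫ ω : EuclideanSpace ℝ ι, exp (-(∑ x ∈ S.biUnion cell, w x (ω x + ψ₀ x))) * -(∑ x ∈ S.biUnion cell, w' x (ω x + ψ₀ x) * h x) ∂(multivariateGaussian 0 Γ))) /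
          (∫ ω : EuclideanSpace ℝ ι, exp (-(∑ x ∈ S.biUnion cell, w x (ω x + ψ₀ x))) ∂(multivariateGaussian 0 Γ)) ^ 2| ≤
      ((κ₁ ^ 3 * ((S.biUnion cell).card : ℝ) ^ 2 * (∑ x ∈ S.biUnion cell, |h x| ^ 3) * ((1 + 2 * (δ₀ ^ 2)⁻¹) * exp (2 * ((1 : ℝ) * ((Δ : ℝ) + 1) * (2 * (Real.exp 1 * (((max (exp (v * (b + δ₀ * r ^ 2)) - 1) (2 * exp (-((κ / 2 - (κ₀ + δ₀)) * r ^ 2)))) * exp (κ * (1 + τ⁻¹) * Ψ ^ 2 / 2)) * ((1 - θ) ^ (-(κ * (1 + τ) * γ / (2 * θ)))) ^ v)))))) + 3 * (κ₂ * (∑ x ∈ S.biUnion cell, h x ^ 2)) * (κ₁ * (∑ x ∈ S.biUnion cell, |h x|) * ((1 + δ₀⁻¹) * exp (2 * ((1 : ℝ) * ((Δ : ℝ) + 1) * (2 * (Real.exp 1 * (((max (exp (v * (b + δ₀ * r ^ 2)) - 1) (2 * exp (-((κ / 2 - (κ₀ + δ₀)) * r ^ 2)))) * exp (κ * (1 +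 τ⁻¹) * Ψ ^ 2 / 2)) * ((1 - θ) ^ (-(κ * (1 + τ) * γ / (2 * θ)))) ^ v))))))) + κ₃ * (∑ x ∈ S.biUnion cell, |h x| ^ 3)) +
          3 * (κ₁ * (∑ x ∈ S.biUnion cell, |h x|) * ((1 + δ₀⁻¹) * exp (2 * ((1 : ℝ) * ((Δ : ℝ) + 1) * (2 * (Real.exp 1 * (((max (exp (v * (b + δ₀ * r ^ 2)) - 1) (2 * exp (-((κ / 2 - (κ₀ + δ₀)) * r ^ 2)))) * exp (κ * (1 + τ⁻¹) * Ψ ^ 2 / 2)) * ((1 - θ) ^ (-(κ * (1 + τ) * γ / (2 * θ)))) ^ v))))))) * (κ₁ ^ 2 * (S.biUnion cell).card * (∑ x ∈ S.biUnion cell, h x ^ 2) * (δ₀⁻¹ * exp (2 * ((1 : ℝ) * ((Δ : ℝ) + 1) * (2 * (Real.exp 1 * (((max (exp (v * (b + δ₀ * r ^ 2)) - 1) (2 * exp (-((κ / 2 - (κ₀ + δ₀)) * r ^ 2)))) * exp (κ * (1 + τ⁻¹) * Ψ ^ 2 / 2)) * ((1 - θ) ^ (-(κ * (1 + τ) * γ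 / (2 * θ)))) ^ v)))))) + κ₂ * (∑ x ∈ S.biUnion cell, h x ^ 2)) + 2 * (κ₁ * (∑ x ∈ S.biUnion cell, |h x|) * ((1 + δ₀⁻¹) * exp (2 * ((1 : ℝ) * ((Δ : ℝ) + 1) * (2 * (Real.exp 1 * (((max (exp (v * (b + δ₀ * r ^ 2)) - 1) (2 * exp (-((κ / 2 - (κ₀ + δ₀)) * r ^ 2)))) * exp (κ * (1 + τ⁻¹) * Ψ ^ 2 / 2)) * ((1 - θ) ^ (-(κ * (1 + τ) * γ / (2 * θ)))) ^ v))))))) ^ 3) / 2 ∧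
    |((∫ ω : EuclideanSpace ℝ ι, exp (-(∑ x ∈ S.biUnion cell, w x (ω x + (ψ₀ x + h x)))) * ((∑ x ∈ S.biUnion cell, w' x (ω x + (ψ₀ x + h x)) * h x) * (∑ x ∈ S.biUnion cell, w' x (ω x + (ψ₀ x + h x)) * h x) - (∑ x ∈ S.biUnion cell, w'' x (ω x + (ψ₀ x + h x)) * h x ^ 2)) ∂(multivariateGaussian 0 Γ)) *
            (∫ ω : EuclideanSpace ℝ ι, exp (-(∑ x ∈ S.biUnion cell, w x (ω x + (ψ₀ x + h x)))) ∂(multivariateGaussian 0 Γ)) -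
          (∫ ω : EuclideanSpace ℝ ι, exp (-(∑ x ∈ S.biUnion cell, w x (ω x + (ψ₀ x + h x)))) * -(∑ x ∈ S.biUnion cell, w' x (ω x + (ψ₀ x + h x)) * h x) ∂(multivariateGaussian 0 Γ)) *
            (∫ ω : EuclideanSpace ℝ ι, exp (-(∑ x ∈ S.biUnion cell, w x (ω x + (ψ₀ x + h x)))) * -(∑ x ∈ S.biUnion cell, w' x (ω x + (ψ₀ x + h x)) * h x) ∂(multivariateGaussian 0 Γ))) /
          (∫ ω : EuclideanSpace ℝ ι, exp (-(∑ x ∈ S.biUnion cell, w x (ω x + (ψ₀ x + h x)))) ∂(multivariateGaussian 0 Γ)) ^ 2 -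
        ((∫ ω : EuclideanSpace ℝ ι, exp (-(∑ x ∈ S.biUnion cell, w x (ω x + ψ₀ x))) * ((∑ x ∈ S.biUnion cell, w' x (ω x + ψ₀ x) * h x) * (∑ x ∈ S.biUnion cell, w' x (ω x + ψ₀ x) * h x) - (∑ x ∈ S.biUnion cell, w'' x (ω x + ψ₀ x) * h x ^ 2)) ∂(multivariateGaussian 0 Γ)) *
            (∫ ω : EuclideanSpace ℝ ι, exp (-(∑ x ∈ S.biUnion cell, w x (ω x + ψ₀ x))) ∂(multivariateGaussian 0 Γ)) -
          (∫ ω : EuclideanSpace ℝ ι, exp (-(∑ x ∈ S.biUnion cell, w x (ω x + ψ₀ x))) * -(∑ x ∈ S.biUnion cell, w' x (ω x + ψ₀ x) * h x) ∂(multivariateGaussian 0 Γ)) *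
            (∫ ω : EuclideanSpace ℝ ι, exp (-(∑ x ∈ S.biUnion cell, w x (ω x + ψ₀ x))) * -(∑ x ∈ S.biUnion cell, w' x (ω x + ψ₀ x) * h x) ∂(multivariateGaussian 0 Γ))) /
          (∫ ω : EuclideanSpace ℝ ι, exp (-(∑ x ∈ S.biUnion cell, w x (ω x + ψ₀ x))) ∂(multivariateGaussian 0 Γ)) ^ 2| ≤
      ((κ₁ ^ 3 * ((S.biUnion cell).card : ℝ) ^ 2 * (∑ x ∈ S.biUnion cell, |h x| ^ 3) * ((1 + 2 * (δ₀ ^ 2)⁻¹) * exp (2 * ((1 : ℝ) * ((Δ : ℝ) + 1) * (2 * (Real.exp 1 * (((max (exp (v * (b + δ₀ * r ^ 2)) - 1) (2 * exp (-((κ / 2 - (κ₀ + δ₀)) * r ^ 2)))) * exp (κ * (1 + τ⁻¹) * Ψ ^ 2 / 2)) * ((1 - θ) ^ (-(κ * (1 + τ) * γ / (2 * θ)))) ^ v)))))) + 3 * (κ₂ * (∑ x ∈ S.biUnion cell, h x ^ 2)) * (κ₁ * (∑ x ∈ S.biUnion cell, |h x|) * ((1 + δ₀⁻¹) * exp (2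 * ((1 : ℝ) * ((Δ : ℝ) + 1) * (2 * (Real.exp 1 * (((max (exp (v * (b + δ₀ * r ^ 2)) - 1) (2 * exp (-((κ / 2 - (κ₀ + δ₀)) * r ^ 2)))) * exp (κ * (1 + τ⁻¹) * Ψ ^ 2 / 2)) * ((1 - θ) ^ (-(κ * (1 + τ) * γ / (2 * θ)))) ^ v))))))) + κ₃ * (∑ x ∈ S.biUnion cell, |h x| ^ 3)) +
          3 * (κ₁ * (∑ x ∈ S.biUnion cell, |h x|) * ((1 + δ₀⁻¹) * exp (2 * ((1 : ℝ) * ((Δ : ℝ) + 1) * (2 * (Real.exp 1 * (((max (exp (v * (b + δ₀ * r ^ 2)) - 1) (2 * exp (-((κ / 2 - (κ₀ + δ₀)) * r ^ 2)))) * exp (κ * (1 + τ⁻¹) * Ψ ^ 2 / 2)) * ((1 - θ) ^ (-(κ * (1 + τ) * γ / (2 * θ)))) ^ v))))))) * (κ₁ ^ 2 * (S.biUnion cell).card * (∑ x ∈ S.biUnion cell, h x ^ 2) * (δ₀⁻¹ * exp (2 * ((1 : ℝ) * ((Δ : ℝ) + 1) * (2 * (Real.exp 1 * (((max (exp (v *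 (b + δ₀ * r ^ 2)) - 1) (2 * exp (-((κ / 2 - (κ₀ + δ₀)) * r ^ 2)))) * exp (κ * (1 + τ⁻¹) * Ψ ^ 2 / 2)) * ((1 - θ) ^ (-(κ * (1 + τ) * γ / (2 * θ)))) ^ v)))))) + κ₂ * (∑ x ∈ S.biUnion cell, h x ^ 2)) + 2 * (κ₁ * (∑ x ∈ S.biUnion cell, |h x|) * ((1 + δ₀⁻¹) * exp (2 * ((1 : ℝ) * ((Δ : ℝ) + 1) * (2 * (Real.exp 1 * (((max (exp (v * (b + δ₀ * r ^ 2)) - 1) (2 * exp (-((κ / 2 - (κ₀ + δ₀)) * r ^ 2)))) * exp (κ * (1 + τ⁻¹) * Ψ ^ 2 / 2)) * ((1 - θ) ^ (-(κ * (1 + τ) * γ / (2 * θ)))) ^ v))))))) ^ 3) := by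
  have hwm : ∀ x, Measurable (w x) := fun x => (continuous_iff_continuousAt.2 fun u => (hw' x u).continuousAt).measurable
  have hδ : 0 < δ₀ * (1 + τ) / 2 := by positivity
  have hκθ' : (2 * κ₀ * (1 + τ) + 4 * (δ₀ * (1 + τ) / 2)) * γop ≤ θ := by
    have e : (2 * κ₀ * (1 + τ) + 4 * (δ₀ * (1 + τ) / 2)) = 2 * (κ₀ + δ₀) * (1 + τ) := by ring
    rw [e]
    exact mul_opBound_le_of_le (a := 2 * (κ₀ + δ₀) * (1 + τ)) (b := κ * (1 + τ)) (by positivity)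
      (mul_le_mul_of_nonneg_right hκ (by linarith)) hθ0.le hκθ
  have l1 := letter_phi hΓ hΓop hdiag hγ hfr hdisj hv hR hΔ hnbr hwm hκ₀ hδ₀ hb hr hstab hsup hκ hτ hθ0 hθ1 hκθ S ψ₀ h hψ0 hψ1 hsmall
    (φ := fun u => |u|) (a := 1 + δ₀⁻¹) continuous_abs.measurable (fun u => abs_nonneg u) (fun u => abs_le_mul_exp_sq hδ₀ u)
  have l2 := letter_phi hΓ hΓop hdiag hγ hfr hdisj hv hR hΔ hnbr hwm hκ₀ hδ₀ hb hr hstab hsup hκ hτ hθ0 hθ1 hκθ S ψ₀ h hψ0 hψ1 hsmall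
    (φ := fun u => u ^ 2) (a := δ₀⁻¹) (measurable_id.pow_const 2) (fun u => sq_nonneg u) (fun u => sq_le_inv_mul_exp_sq hδ₀ u)
  have l3 := letter_phi hΓ hΓop hdiag hγ hfr hdisj hv hR hΔ hnbr hwm hκ₀ hδ₀ hb hr hstab hsup hκ hτ hθ0 hθ1 hκθ S ψ₀ h hψ0 hψ1 hsmall
    (φ := fun u => |u| ^ 3) (a := 1 + 2 * (δ₀ ^ 2)⁻¹) (continuous_abs.measurable.pow_const 3) (fun u => by positivity)
    (fun u => abs_cube_le_mul_exp_sq hδ₀ u)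
  exact cubic_taylor_line hΓ hΓop (S.biUnion cell) hw' hw'' hw₃ hw₃m hκ₀ hκ₁ hκ₂ hκ₃ hτ hδ hθ0.le hθ1 hκθ' hstab hw'b hw''b hw₃b ψ₀ h
    (fun t ht x hx => (l1 t ht x hx).1) (fun t ht x hx => (l1 t ht x hx).2) (fun t ht x hx => (l2 t ht x hx).1)
    (fun t ht x hx => (l2 t ht x hx).2) (fun t ht x hx => (l3 t ht x hx).1) (fun t ht x hx => (l3 t ht x hx).2)

end Main

/-! ## §4. Toy -/

/-- Toy (§1): at `δ = 1`, `|t| ≤ 2e^{t²}`. -/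
example (t : ℝ) : |t| ≤ (1 + (1 : ℝ)⁻¹) * exp (1 * t ^ 2) := abs_le_mul_exp_sq one_pos t

end Summit.QuantumFields.BalabanUV.T4Continuum.NE7b.SupNextPotentialCubicRoad
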